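import Literature.ModelTheory.ExponentialFields.CharbonnelWeakStructure
import Mathlib.Topology.Baire.Lemmas
import Mathlib.Topology.Baire.LocallyCompactRegular
import Mathlib.Topology.GDelta.Basic
import Mathlib.Topology.Compactness.SigmaCompact
import HarnessLib

/-!
# Regularity of the Charbonnel closure over `ℝ`: empty interior is preserved by closure

Topic `Literature/ModelTheory/ExponentialFields`.  The key regularity property of the sets of the
Charbonnel closure `𝒮̃` (`IsCh`, `CharbonnelClosure.lean`) used throughout Wilkie's theorem of the
complement: **if `A ∈ 𝒮̃ₙ` has empty interior then so does its closure** (J.-Y. Charbonnel, Ann.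
Inst. Fourier 41 (1991), §5, propriété `Pₙ`; A. Berarducci, T. Servi, Ann. Pure Appl. Logic 125
(2004), Lemma 6.9: "*If `A ∈ 𝒮̃ₙ` has empty interior, then so does `Ā`*" (after Charbonnel and
Maxwell); A. Fornasiero, T. Servi, Fund. Math. 209 (2010), Lemma 7.25 (1) ⇒ (2)).  The proof given
here is by induction on `n` through the fibres over `ℝⁿ⁻¹`, using only Baire category (the sets
of `𝒮̃` are σ-compact), the finiteness of the sets of `𝒮̃₁` with empty interior, and the weak
structure operations (`CharbonnelWeakStructure.lean`): off a meagre set of `x ∈ ℝⁿ⁻¹` the fibre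
`Aₓ` is finite and the fibre of the closure is contained in the closure of the fibre (the
exceptional `x` lie on frontiers of projections `π(A ∩ (ℝⁿ⁻¹ × [a, b]))`, `a < b` rational, which
are nowhere dense by the induction hypothesis), so that the closed set `cl A` has finite fibres
over a comeagre set and hence empty interior.

* `IsCh.isSigmaCompact` — sets of `𝒮̃` are σ-compact;
* `IsCh.finite_of_interior_eq_empty` — a set of `𝒮̃₁` with empty interior is finite;
* `IsCh.Icc1`, `IsCh.Ioo1`, `IsCh.closedBall`, `IsCh.fiber1`, … — semialgebraic members, fibres;
* **`IsCh.interior_closure_eq_empty`** — the theorem; corollaries `IsCh.isNowhereDense`,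
  `IsCh.interior_closure_subset`, `IsCh.isNowhereDense_frontier`,
  `IsCh.isMeagre_iff_interior_eq_empty`.

Everything is proved; no named facts.

## References

* [Charbonnel1991] J.-Y. Charbonnel, Ann. Inst. Fourier 41 (1991), §5 (propriétés `Pₙ`, `P'ₙ`).
* [BerarducciServi2004] A. Berarducci, T. Servi, Ann. Pure Appl. Logic 125 (2004), Lemma 6.9.
* [FornasieroServi2010] A. Fornasiero, T. Servi, Fund. Math. 209 (2010), Lemma 7.25.
* [Wilkie1999] A. J. Wilkie, Selecta Math. (N.S.) 5 (1999), §2 (not held).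
-/

noncomputable section

open Set Function Metric Filter Topology FirstOrder FirstOrder.Language

namespace Literature.ModelTheory.ExponentialFields

/-! ### σ-compactness -/

/-- Sets of the Charbonnel closure are σ-compact (projections of closed sets).
[cite: FornasieroServi2010, Lemma 7.25] -/
theorem IsCh.isSigmaCompact {n : ℕ} {A : Set (Fin n → ℝ)} (hA : IsCh A) : IsSigmaCompact A := by
  obtain ⟨l, rfl⟩ := hA.exists_pieces
  rw [piecesSet_eq_biUnion]
  refine isSigmaCompact_biUnion (List.finite_toSet l).countable fun P _ => ?_
  exact (isSigmaCompact_univ.of_isClosed_subset (NF.isClosed_toSet P.C P.p) (subset_univ _)).image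
    (continuous_precompCoord _)

/-! ### Dimension one -/

/-- **A set of `𝒮̃₁` with empty interior is finite** (finitely many components, each a point).
[cite: Charbonnel1991, Lemme 3 (iii)] -/
theorem IsCh.finite_of_interior_eq_empty {S : Set (Fin 1 → ℝ)} (hS : IsCh S) (h : interior S = ∅) :
    S.Finite := by
  have hfin := hS.finite_connectedComponents
  -- each component is a subsingleton
  have hsub : ∀ x : S, (connectedComponentIn S (x : Fin 1 → ℝ)).Subsingleton := by
    intro x v hv w hw
    by_contra hne
    have h0 : v 0 ≠ w 0 := by
      intro h0; apply hne; ext i; fin_cases i; exact h0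
    -- the image of the component in `ℝ` is order-connected
    have hpre : IsPreconnected ((fun u : Fin 1 → ℝ => u 0) '' connectedComponentIn S (x : Fin 1 → ℝ)) :=
      isPreconnected_connectedComponentIn.image _ (continuous_apply 0).continuousOn
    have hord : OrdConnected ((fun u : Fin 1 → ℝ => u 0) '' connectedComponentIn S (x : Fin 1 → ℝ)) :=
      isPreconnected_iff_ordConnected.1 hpre
    have hCS : connectedComponentIn S (x : Fin 1 → ℝ) ⊆ S := connectedComponentIn_subset _ _
    -- an open interval between `v 0` and `w 0` lies in `S`
    have key : ∀ {p q : Fin 1 → ℝ}, p ∈ connectedComponentIn S (x : Fin 1 → ℝ) →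
        q ∈ connectedComponentIn S (x : Fin 1 → ℝ) → p 0 < q 0 → False := by
      intro p q hp hq hpq
      have hI : Icc (p 0) (q 0) ⊆ (fun u : Fin 1 → ℝ => u 0) '' connectedComponentIn S (x : Fin 1 → ℝ) :=
        hord.out ⟨p, hp, rfl⟩ ⟨q, hq, rfl⟩
      have hopen : IsOpen {u : Fin 1 → ℝ | u 0 ∈ Ioo (p 0) (q 0)} :=
        isOpen_Ioo.preimage (continuous_apply 0)
      have hsubS : {u : Fin 1 → ℝ | u 0 ∈ Ioo (p 0) (q 0)} ⊆ S := by
        intro u hu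
        obtain ⟨c, hc, hcu⟩ := hI (Ioo_subset_Icc_self hu)
        have : c = u := by ext i; fin_cases i; exact hcu
        rw [← this]; exact hCS hc
      have hne' : ({u : Fin 1 → ℝ | u 0 ∈ Ioo (p 0) (q 0)}).Nonempty := by
        refine ⟨fun _ => (p 0 + q 0) / 2, ?_⟩
        simp only [mem_setOf_eq, mem_Ioo]; constructor <;> linarith
      have hint : ({u : Fin 1 → ℝ | u 0 ∈ Ioo (p 0) (q 0)}) ⊆ interior S :=
        interior_maximal hsubS hopen
      rw [h] at hint
      exact absurd (hint hne'.some_mem) (notMem_empty _)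
    rcases lt_or_gt_of_ne h0 with hlt | hlt
    · exact key hv hw hlt
    · exact key hw hv hlt
  have hcover : S ⊆ ⋃ C ∈ Set.range (fun x : S => connectedComponentIn S (x : Fin 1 → ℝ)), C := by
    intro v hv
    exact mem_biUnion ⟨⟨v, hv⟩, rfl⟩ (mem_connectedComponentIn hv)
  refine (hfin.biUnion fun C hC => ?_).subset hcover
  obtain ⟨x, rfl⟩ := hC
  exact (hsub x).finite

/-! ### Semialgebraic members -/

section Semialgebraic

/-- The term `(x₀ - a - s²)² + (b - x₀ - s'²)²` with parameters `(a, b)` on `ℝ¹⁺²`. [folklore] -/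
def IccTerm : Language.orderedExpRing.Term (Fin 2 ⊕ Fin (1 + 2)) :=
  sqT (Term.var (Sum.inr (Fin.castAdd 2 0)) + -Term.var (Sum.inl 0) +
      -sqT (Term.var (Sum.inr (Fin.natAdd 1 0)))) +
    sqT (Term.var (Sum.inl 1) + -Term.var (Sum.inr (Fin.castAdd 2 0)) +
      -sqT (Term.var (Sum.inr (Fin.natAdd 1 1))))

/-- `{v ∈ ℝ¹ | a ≤ v₀ ≤ b} ∈ 𝒮̃₁`. [cite: FornasieroServi2010, Def. 7.2] -/
theorem IsCh.Icc1 (a b : ℝ) : IsCh {v : Fin 1 → ℝ | a ≤ v 0 ∧ v 0 ≤ b} := by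
  have h := (IsCh.zero IccTerm ![a, b]).projLast (n := 1) (e := 2)
  have hset : (fun w : Fin (1 + 2) → ℝ => w ∘ Fin.castAdd 2) '' zeroLocus IccTerm ![a, b] =
      {v : Fin 1 → ℝ | a ≤ v 0 ∧ v 0 ≤ b} := by
    ext v
    simp only [mem_image, zeroLocus, IccTerm, realize_sqT, mem_setOf_eq,
      Language.orderedExpRing.realize_add, Language.orderedExpRing.realize_neg, Term.realize_var,
      Sum.elim_inl, Sum.elim_inr, Matrix.cons_val_zero, Matrix.cons_val_one]
    constructor
    · rintro ⟨w, hw, rfl⟩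
      have h1 : (w (Fin.castAdd 2 0) + -a + -(w (Fin.natAdd 1 0) * w (Fin.natAdd 1 0))) = 0 := by
        nlinarith [mul_self_nonneg (w (Fin.castAdd 2 0) + -a + -(w (Fin.natAdd 1 0) * w (Fin.natAdd 1 0))),
          mul_self_nonneg (b + -w (Fin.castAdd 2 0) + -(w (Fin.natAdd 1 1) * w (Fin.natAdd 1 1)))]
      have h2 : (b + -w (Fin.castAdd 2 0) + -(w (Fin.natAdd 1 1) * w (Fin.natAdd 1 1))) = 0 := by
        nlinarith [mul_self_nonneg (w (Fin.castAdd 2 0) + -a + -(w (Fin.natAdd 1 0) * w (Fin.natAdd 1 0))),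
          mul_self_nonneg (b + -w (Fin.castAdd 2 0) + -(w (Fin.natAdd 1 1) * w (Fin.natAdd 1 1)))]
      simp only [Function.comp_apply]
      constructor
      · nlinarith [mul_self_nonneg (w (Fin.natAdd 1 0))]
      · nlinarith [mul_self_nonneg (w (Fin.natAdd 1 1))]
    · rintro ⟨ha, hb⟩
      refine ⟨Fin.append v ![Real.sqrt (v 0 - a), Real.sqrt (b - v 0)], ?_, append_comp_castAdd _ _⟩
      have e0 : Fin.append v ![Real.sqrt (v 0 - a), Real.sqrt (b - v 0)] (Fin.castAdd 2 0) = v 0 := by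
        rw [Fin.append_left]
      have e1 : Fin.append v ![Real.sqrt (v 0 - a), Real.sqrt (b - v 0)] (Fin.natAdd 1 0) =
          Real.sqrt (v 0 - a) := by rw [Fin.append_right]; rfl
      have e2 : Fin.append v ![Real.sqrt (v 0 - a), Real.sqrt (b - v 0)] (Fin.natAdd 1 1) =
          Real.sqrt (b - v 0) := by rw [Fin.append_right]; rfl
      rw [e0, e1, e2, Real.mul_self_sqrt (by linarith), Real.mul_self_sqrt (by linarith)]
      ring
  rw [hset] at h
  exact h

/-- The term `((x₀ - a) s² - 1)² + ((b - x₀) s'² - 1)²` with parameters `(a, b)`. [folklore] -/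
def IooTerm : Language.orderedExpRing.Term (Fin 2 ⊕ Fin (1 + 2)) :=
  sqT ((Term.var (Sum.inr (Fin.castAdd 2 0)) + -Term.var (Sum.inl 0)) *
        sqT (Term.var (Sum.inr (Fin.natAdd 1 0))) + -1) +
    sqT ((Term.var (Sum.inl 1) + -Term.var (Sum.inr (Fin.castAdd 2 0))) *
        sqT (Term.var (Sum.inr (Fin.natAdd 1 1))) + -1)

/-- `{v ∈ ℝ¹ | a < v₀ < b} ∈ 𝒮̃₁`. [cite: FornasieroServi2010, Def. 7.2] -/
theorem IsCh.Ioo1 (a b : ℝ) : IsCh {v : Fin 1 → ℝ | a < v 0 ∧ v 0 < b} := by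
  have h := (IsCh.zero IooTerm ![a, b]).projLast (n := 1) (e := 2)
  have hset : (fun w : Fin (1 + 2) → ℝ => w ∘ Fin.castAdd 2) '' zeroLocus IooTerm ![a, b] =
      {v : Fin 1 → ℝ | a < v 0 ∧ v 0 < b} := by
    ext v
    simp only [mem_image, zeroLocus, IooTerm, realize_sqT, mem_setOf_eq,
      Language.orderedExpRing.realize_add, Language.orderedExpRing.realize_neg,
      Language.orderedExpRing.realize_mul, Language.orderedExpRing.realize_one, Term.realize_var,
      Sum.elim_inl, Sum.elim_inr, Matrix.cons_val_zero, Matrix.cons_val_one]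
    constructor
    · rintro ⟨w, hw, rfl⟩
      set p := (w (Fin.castAdd 2 0) + -a) * (w (Fin.natAdd 1 0) * w (Fin.natAdd 1 0)) + -1 with hp
      set q := (b + -w (Fin.castAdd 2 0)) * (w (Fin.natAdd 1 1) * w (Fin.natAdd 1 1)) + -1 with hq
      have h1 : p = 0 := by nlinarith [mul_self_nonneg p, mul_self_nonneg q]
      have h2 : q = 0 := by nlinarith [mul_self_nonneg p, mul_self_nonneg q]
      simp only [Function.comp_apply]
      constructor
      · by_contra hle
        push Not at hle
        have : (w (Fin.castAdd 2 0) + -a) * (w (Fin.natAdd 1 0) * w (Fin.natAdd 1 0)) ≤ 0 :=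
          mul_nonpos_of_nonpos_of_nonneg (by linarith) (mul_self_nonneg _)
        rw [hp] at h1; linarith
      · by_contra hle
        push Not at hle
        have : (b + -w (Fin.castAdd 2 0)) * (w (Fin.natAdd 1 1) * w (Fin.natAdd 1 1)) ≤ 0 :=
          mul_nonpos_of_nonpos_of_nonneg (by linarith) (mul_self_nonneg _)
        rw [hq] at h2; linarith
    · rintro ⟨ha, hb⟩
      refine ⟨Fin.append v ![Real.sqrt (1 / (v 0 - a)), Real.sqrt (1 / (b - v 0))], ?_,
        append_comp_castAdd _ _⟩
      have e0 : Fin.append v ![Real.sqrt (1 / (v 0 - a)), Real.sqrt (1 / (b - v 0))] (Fin.castAdd 2 0) =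
          v 0 := by rw [Fin.append_left]
      have e1 : Fin.append v ![Real.sqrt (1 / (v 0 - a)), Real.sqrt (1 / (b - v 0))] (Fin.natAdd 1 0) =
          Real.sqrt (1 / (v 0 - a)) := by rw [Fin.append_right]; rfl
      have e2 : Fin.append v ![Real.sqrt (1 / (v 0 - a)), Real.sqrt (1 / (b - v 0))] (Fin.natAdd 1 1) =
          Real.sqrt (1 / (b - v 0)) := by rw [Fin.append_right]; rfl
      have ha' : 0 < v 0 - a := by linarith
      have hb' : 0 < b - v 0 := by linarith
      rw [e0, e1, e2, Real.mul_self_sqrt (by positivity), Real.mul_self_sqrt (by positivity)]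
      field_simp
      ring
  rw [hset] at h
  exact h

/-- Closed coordinate slabs `{w | a ≤ wᵢ ≤ b}`. [cite: FornasieroServi2010, Def. 7.2] -/
theorem IsCh.slab {n : ℕ} (i : Fin n) (a b : ℝ) : IsCh {w : Fin n → ℝ | a ≤ w i ∧ w i ≤ b} := by
  have h := (IsCh.Icc1 a b).preimage_precomp (σ := fun _ : Fin 1 => i)
    (fun x y _ => Subsingleton.elim x y)
  exact h

/-- Open coordinate slabs `{w | a < wᵢ < b}`. [cite: FornasieroServi2010, Def. 7.2] -/
theorem IsCh.openSlab {n : ℕ} (i : Fin n) (a b : ℝ) : IsCh {w : Fin n → ℝ | a < w i ∧ w i < b} := by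
  have h := (IsCh.Ioo1 a b).preimage_precomp (σ := fun _ : Fin 1 => i)
    (fun x y _ => Subsingleton.elim x y)
  exact h

/-- Closed balls of the sup metric (closed cubes) are in `𝒮̃`. [cite: FornasieroServi2010, Def. 7.2] -/
theorem IsCh.closedBall {n : ℕ} (z : Fin n → ℝ) (r : ℝ) : IsCh (Metric.closedBall z r) := by
  rcases lt_or_ge r 0 with hr | hr
  · rw [Metric.closedBall_eq_empty.2 hr]; exact IsCh.empty n
  have hset : Metric.closedBall z r = ⋂ i ∈ (Finset.univ : Finset (Fin n)),
      {w : Fin n → ℝ | z i - r ≤ w i ∧ w i ≤ z i + r} := by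
    ext w
    simp only [Metric.mem_closedBall, Finset.mem_univ, iInter_true, mem_iInter, mem_setOf_eq,
      dist_pi_le_iff hr, Real.dist_eq, abs_le]
    refine forall_congr' fun i => ?_
    constructor <;> intro h <;> constructor <;> linarith [h.1, h.2]
  rw [hset]
  exact IsCh.iInter_finset _ fun i _ => IsCh.slab i _ _

end Semialgebraic

/-! ### Fibres over `ℝᵐ` (last coordinate) -/

section Fiber

variable {m : ℕ}

/-- The fibre `Aₓ = {t | (x, t) ∈ A} ⊆ ℝ` of `A ⊆ ℝᵐ⁺¹` over `x ∈ ℝᵐ`. [folklore] -/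
def lastFiber (A : Set (Fin (m + 1) → ℝ)) (x : Fin m → ℝ) : Set ℝ := {t | (Fin.snoc x t : Fin (m + 1) → ℝ) ∈ A}

/-- The fibre as a subset of `ℝ¹`. [folklore] -/
def lastFiber1 (A : Set (Fin (m + 1) → ℝ)) (x : Fin m → ℝ) : Set (Fin 1 → ℝ) :=
  {v | (Fin.snoc x (v 0) : Fin (m + 1) → ℝ) ∈ A}

/-- `t ↦ (x, t)` is continuous. [folklore] -/
theorem continuous_snoc_lastCoord (x : Fin m → ℝ) :
    Continuous fun t : ℝ => (Fin.snoc x t : Fin (m + 1) → ℝ) := by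
  refine continuous_pi fun i => ?_
  induction i using Fin.lastCases with
  | last => simp only [Fin.snoc_last]; exact continuous_id
  | cast i => simp only [Fin.snoc_castSucc]; exact continuous_const

/-- `x ↦ (x, t)` is continuous. [folklore] -/
theorem continuous_snoc_initCoords (t : ℝ) :
    Continuous fun x : Fin m → ℝ => (Fin.snoc x t : Fin (m + 1) → ℝ) := by
  refine continuous_pi fun i => ?_
  induction i using Fin.lastCases with
  | last => simp only [Fin.snoc_last]; exact continuous_const
  | cast i => simp only [Fin.snoc_castSucc]; exact continuous_apply i

/-- `(x, t) ↦ (x, t)` is jointly continuous. [folklore] -/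
theorem continuous_snoc₂ :
    Continuous fun q : (Fin m → ℝ) × ℝ => (Fin.snoc q.1 q.2 : Fin (m + 1) → ℝ) := by
  refine continuous_pi fun i => ?_
  induction i using Fin.lastCases with
  | last => simp only [Fin.snoc_last]; exact continuous_snd
  | cast i => simp only [Fin.snoc_castSucc]; exact (continuous_apply i).comp continuous_fst

/-- The linear map `v ↦ (0, v₀)`. [folklore] -/
def snocLinear (m : ℕ) : (Fin 1 → ℝ) →ₗ[ℝ] (Fin (m + 1) → ℝ) where
  toFun v := Fin.snoc (0 : Fin m → ℝ) (v 0)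
  map_add' v w := by
    ext i
    induction i using Fin.lastCases with
    | last => simp
    | cast i => simp
  map_smul' r v := by
    ext i
    induction i using Fin.lastCases with
    | last => simp
    | cast i => simp

/-- `(x, v₀) = snocLinear v + (x, 0)`. [folklore] -/
theorem snoc_eq_snocLinear_add (x : Fin m → ℝ) (v : Fin 1 → ℝ) :
    (Fin.snoc x (v 0) : Fin (m + 1) → ℝ) = snocLinear m v + Fin.snoc x 0 := by
  ext i
  induction i using Fin.lastCases with
  | last => simp [snocLinear]
  | cast i => simp [snocLinear]

/-- **Fibres of sets of `𝒮̃` are in `𝒮̃₁`.** [cite: FornasieroServi2010, Thm. 7.4] -/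
theorem IsCh.lastFiber1_isCh {A : Set (Fin (m + 1) → ℝ)} (hA : IsCh A) (x : Fin m → ℝ) :
    IsCh (lastFiber1 A x) := by
  have h := hA.preimage_affine (snocLinear m) (Fin.snoc x 0)
  have : {y : Fin 1 → ℝ | snocLinear m y + Fin.snoc x 0 ∈ A} = lastFiber1 A x := by
    ext v; simp [lastFiber1, snoc_eq_snocLinear_add]
  rw [this] at h; exact h

/-- `fiber1` versus `fiber`. [folklore] -/
theorem fiber1_eq (A : Set (Fin (m + 1) → ℝ)) (x : Fin m → ℝ) :
    lastFiber1 A x = (fun v : Fin 1 → ℝ => v 0) ⁻¹' lastFiber A x := rfl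

/-- If the fibre has empty interior in `ℝ`, so has `fiber1` in `ℝ¹`. [folklore] -/
theorem interior_lastFiber1_eq_empty {A : Set (Fin (m + 1) → ℝ)} {x : Fin m → ℝ}
    (h : interior (lastFiber A x) = ∅) : interior (lastFiber1 A x) = ∅ := by
  by_contra hne
  obtain ⟨v, hv⟩ := nonempty_iff_ne_empty.2 hne
  rw [mem_interior_iff_mem_nhds, Metric.mem_nhds_iff] at hv
  obtain ⟨ε, hε, hball⟩ := hv
  have : Metric.ball (v 0) ε ⊆ lastFiber A x := by
    intro t ht
    have hmem : (fun _ : Fin 1 => t) ∈ Metric.ball v ε := by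
      rw [Metric.mem_ball, dist_pi_lt_iff hε]
      intro i; fin_cases i; simpa using ht
    exact hball hmem
  have hint : Metric.ball (v 0) ε ⊆ interior (lastFiber A x) := interior_maximal this Metric.isOpen_ball
  rw [h] at hint
  exact absurd (hint (Metric.mem_ball_self hε)) (notMem_empty _)

/-- Off the fibres with non-empty interior, the fibres of a set of `𝒮̃` are finite.
[cite: Charbonnel1991, Lemme 5.5] -/
theorem IsCh.finite_lastFiber {A : Set (Fin (m + 1) → ℝ)} (hA : IsCh A) {x : Fin m → ℝ}
    (h : interior (lastFiber A x) = ∅) : (lastFiber A x).Finite := by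
  have hfin := (hA.lastFiber1_isCh x).finite_of_interior_eq_empty (interior_lastFiber1_eq_empty h)
  have : lastFiber A x = (fun v : Fin 1 → ℝ => v 0) '' lastFiber1 A x := by
    ext t
    simp only [mem_image]
    constructor
    · intro ht; exact ⟨fun _ => t, ht, rfl⟩
    · rintro ⟨v, hv, rfl⟩; exact hv
  rw [this]
  exact hfin.image _

/-- A point of `ℝᵐ⁺¹` in terms of `init` and `last`. [folklore] -/
theorem snoc_init_last (w : Fin (m + 1) → ℝ) : Fin.snoc (Fin.init w) (w (Fin.last m)) = w :=
  Fin.snoc_init_self w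

/-- The open "box" `{w | init w ∈ O, w_last ∈ J}` is open. [folklore] -/
theorem isOpen_box {O : Set (Fin m → ℝ)} (hO : IsOpen O) {J : Set ℝ} (hJ : IsOpen J) :
    IsOpen {w : Fin (m + 1) → ℝ | Fin.init w ∈ O ∧ w (Fin.last m) ∈ J} :=
  (hO.preimage (continuous_pi fun i => continuous_apply (Fin.castSucc i))).inter
    (hJ.preimage (continuous_apply _))

end Fiber

/-! ### Kuratowski–Ulam for σ-compact sets, easy direction -/

section KU

variable {m : ℕ}

/-- If `A ⊆ ℝᵐ⁺¹` is σ-compact with empty interior, then the set of `x ∈ ℝᵐ` over which the fibre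
`Aₓ ⊆ ℝ` has non-empty interior is meagre. [cite: FornasieroServi2010, Thm. 4.1] -/
theorem isMeagre_setOf_interior_fiber_nonempty {A : Set (Fin (m + 1) → ℝ)} (hA : IsSigmaCompact A)
    (hint : interior A = ∅) : IsMeagre {x : Fin m → ℝ | (interior (lastFiber A x)).Nonempty} := by
  obtain ⟨K, hK, hKA⟩ := hA
  -- the closed nowhere dense sets `T j a b = {x | [a, b] ⊆ (K j)ₓ}`
  let T : ℕ → ℚ → ℚ → Set (Fin m → ℝ) := fun j a b =>
    {x | ∀ t ∈ Icc (a : ℝ) b, (Fin.snoc x t : Fin (m + 1) → ℝ) ∈ K j}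
  have hTclosed : ∀ j a b, IsClosed (T j a b) := by
    intro j a b
    have : T j a b = ⋂ t ∈ Icc (a : ℝ) b, (fun x : Fin m → ℝ => (Fin.snoc x t : Fin (m + 1) → ℝ)) ⁻¹' K j := by
      ext x; simp [T]
    rw [this]
    exact isClosed_biInter fun t _ => (hK j).isClosed.preimage (continuous_snoc_initCoords t)
  have hTnd : ∀ j (a b : ℚ), a < b → IsNowhereDense (T j a b) := by
    intro j a b hab
    rw [(hTclosed j a b).isNowhereDense_iff]
    by_contra hne
    obtain ⟨x₀, hx₀⟩ := nonempty_iff_ne_empty.2 hne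
    rw [mem_interior_iff_mem_nhds, Metric.mem_nhds_iff] at hx₀
    obtain ⟨r, hr, hball⟩ := hx₀
    -- the open box `ball x₀ r × (a, b)` lies in `A`
    let O : Set (Fin (m + 1) → ℝ) := {w | Fin.init w ∈ Metric.ball x₀ r ∧ w (Fin.last m) ∈ Ioo (a : ℝ) b}
    have hOopen : IsOpen O := isOpen_box Metric.isOpen_ball isOpen_Ioo
    have hOA : O ⊆ A := by
      rintro w ⟨hw1, hw2⟩
      have h1 : Fin.init w ∈ T j a b := hball hw1
      have h2 := h1 (w (Fin.last m)) (Ioo_subset_Icc_self hw2)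
      rw [snoc_init_last] at h2
      rw [← hKA]; exact mem_iUnion.2 ⟨j, h2⟩
    have hOne : O.Nonempty := by
      refine ⟨Fin.snoc x₀ (((a : ℝ) + b) / 2), ?_, ?_⟩
      · simp only [Fin.init_snoc]; exact Metric.mem_ball_self hr
      · simp only [Fin.snoc_last, mem_Ioo]
        have : (a : ℝ) < b := by exact_mod_cast hab
        constructor <;> linarith
    have := interior_maximal hOA hOopen
    rw [hint] at this
    exact absurd (this hOne.some_mem) (notMem_empty _)
  -- `{x | (Aₓ)° ≠ ∅} ⊆ ⋃ T j a b` over `a < b` (Baire in `ℝ`)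
  have hsub : {x : Fin m → ℝ | (interior (lastFiber A x)).Nonempty} ⊆
      ⋃ j : ℕ, ⋃ q : {q : ℚ × ℚ // q.1 < q.2}, T j q.1.1 q.1.2 := by
    intro x hx
    obtain ⟨t₀, ht₀⟩ := hx
    rw [mem_interior_iff_mem_nhds, Metric.mem_nhds_iff] at ht₀
    obtain ⟨ε, hε, hεsub⟩ := ht₀
    -- the closed sets `F j = (K j)ₓ` and `(ball t₀ ε)ᶜ` cover `ℝ`
    let F : Option ℕ → Set ℝ := fun o => Option.casesOn o (Metric.ball t₀ ε)ᶜ fun j =>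
      {t | (Fin.snoc x t : Fin (m + 1) → ℝ) ∈ K j}
    have hFclosed : ∀ o, IsClosed (F o) := by
      rintro (_ | j)
      · exact Metric.isOpen_ball.isClosed_compl
      · exact (hK j).isClosed.preimage (continuous_snoc_lastCoord x)
    have hFcover : ⋃ o, F o = Set.univ := by
      refine eq_univ_of_forall fun t => ?_
      by_cases ht : t ∈ Metric.ball t₀ ε
      · have : (Fin.snoc x t : Fin (m + 1) → ℝ) ∈ A := hεsub ht
        rw [← hKA, mem_iUnion] at this
        obtain ⟨j, hj⟩ := this
        exact mem_iUnion.2 ⟨some j, hj⟩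
      · exact mem_iUnion.2 ⟨none, ht⟩
    have hdense := dense_iUnion_interior_of_closed hFclosed hFcover
    obtain ⟨t₁, ht₁, ht₁ball⟩ := hdense.exists_mem_open Metric.isOpen_ball ⟨t₀, Metric.mem_ball_self hε⟩
    rw [mem_iUnion] at ht₁
    obtain ⟨o, ho⟩ := ht₁
    rcases o with _ | j
    · -- interior of the complement of the ball does not meet the ball
      exfalso
      have : t₁ ∈ (Metric.ball t₀ ε)ᶜ := interior_subset ho
      exact this ht₁ball
    · -- an open interval around `t₁` inside `(K j)ₓ`; shrink to a rational closed interval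
      rw [mem_interior_iff_mem_nhds, Metric.mem_nhds_iff] at ho
      obtain ⟨δ, hδ, hδsub⟩ := ho
      obtain ⟨a, ha1, ha2⟩ := exists_rat_btwn (show t₁ - δ < t₁ by linarith)
      obtain ⟨b, hb1, hb2⟩ := exists_rat_btwn (show t₁ < t₁ + δ by linarith)
      have hab : a < b := by exact_mod_cast (ha2.trans hb1)
      refine mem_iUnion.2 ⟨j, mem_iUnion.2 ⟨⟨(a, b), hab⟩, ?_⟩⟩
      intro t ht
      apply hδsub
      rw [Metric.mem_ball, Real.dist_eq, abs_lt]
      constructor <;> linarith [ht.1, ht.2]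
  refine IsMeagre.mono hsub (isMeagre_iUnion fun j => isMeagre_iUnion fun q => ?_)
  exact (hTnd j q.1.1 q.1.2 q.2).isMeagre

end KU

/-! ### The frontier of a set of `𝒮̃` is nowhere dense, given the theorem one dimension down -/

section Frontier

variable {n : ℕ}

/-- From "empty interior ⇒ closure has empty interior" for all sets of `𝒮̃ₙ`:
`int(cl E) ⊆ cl(int E)` for `E ∈ 𝒮̃ₙ`. [cite: BerarducciServi2004, Lemma 6.9] -/
theorem interior_closure_subset_of
    (hR : ∀ A : Set (Fin n → ℝ), IsCh A → interior A = ∅ → interior (closure A) = ∅)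
    {E : Set (Fin n → ℝ)} (hE : IsCh E) : interior (closure E) ⊆ closure (interior E) := by
  intro z hz
  by_contra hzc
  -- a closed cube around `z` inside `int(cl E)` and off `cl(int E)`
  have h1 : interior (closure E) ∈ 𝓝 z := isOpen_interior.mem_nhds hz
  have h2 : (closure (interior E))ᶜ ∈ 𝓝 z := isClosed_closure.isOpen_compl.mem_nhds hzc
  obtain ⟨r, hr, hball⟩ := Metric.mem_nhds_iff.1 (Filter.inter_mem h1 h2)
  have hQ : Metric.closedBall z (r / 2) ⊆ interior (closure E) ∩ (closure (interior E))ᶜ :=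
    (Metric.closedBall_subset_ball (by linarith)).trans hball
  have hEQ : IsCh (E ∩ Metric.closedBall z (r / 2)) := hE.inter (IsCh.closedBall z (r / 2))
  have hintEQ : interior (E ∩ Metric.closedBall z (r / 2)) = ∅ := by
    rw [interior_inter]
    apply eq_empty_of_forall_notMem
    rintro w ⟨hw1, hw2⟩
    have hwE : w ∈ closure (interior E) := subset_closure hw1
    exact (hQ (interior_subset hw2)).2 hwE
  have hcl : interior (closure (E ∩ Metric.closedBall z (r / 2))) = ∅ := hR _ hEQ hintEQ
  -- but `cl(E ∩ Q) ⊇ cl E ∩ ball z (r/2) ⊇ ball z (r/2)`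
  have hsub : Metric.ball z (r / 2) ⊆ closure (E ∩ Metric.closedBall z (r / 2)) := by
    intro w hw
    have hwcl : w ∈ closure E := interior_subset (hQ (Metric.ball_subset_closedBall hw)).1
    have : w ∈ Metric.ball z (r / 2) ∩ closure E := ⟨hw, hwcl⟩
    have h3 := Metric.isOpen_ball.inter_closure this
    have hst : Metric.ball z (r / 2) ∩ E ⊆ E ∩ Metric.closedBall z (r / 2) := fun u hu =>
      ⟨hu.2, Metric.ball_subset_closedBall hu.1⟩
    exact closure_mono hst h3
  have : Metric.ball z (r / 2) ⊆ interior (closure (E ∩ Metric.closedBall z (r / 2))) :=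
    interior_maximal hsub Metric.isOpen_ball
  rw [hcl] at this
  exact absurd (this (Metric.mem_ball_self (by linarith))) (notMem_empty _)

/-- From the same hypothesis: the frontier of a set of `𝒮̃ₙ` is (closed and) nowhere dense.
[cite: BerarducciServi2004, Lemma 6.9] -/
theorem isNowhereDense_frontier_of
    (hR : ∀ A : Set (Fin n → ℝ), IsCh A → interior A = ∅ → interior (closure A) = ∅)
    {E : Set (Fin n → ℝ)} (hE : IsCh E) : IsNowhereDense (frontier E) := by
  rw [isClosed_frontier.isNowhereDense_iff]
  have hsub : frontier E ⊆ frontier (closure E) ∪ frontier (interior E) := by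
    intro w hw
    rw [frontier] at hw
    by_cases h : w ∈ interior (closure E)
    · right
      rw [frontier, interior_interior]
      exact ⟨interior_closure_subset_of hR hE h, hw.2⟩
    · left
      rw [frontier, closure_closure]
      exact ⟨hw.1, h⟩
  apply eq_empty_of_subset_empty
  have h1 : interior (frontier (closure E)) = ∅ := interior_frontier isClosed_closure
  have h2 : interior (frontier (interior E)) = ∅ := by
    rw [← frontier_compl]
    exact interior_frontier isOpen_interior.isClosed_compl
  calc interior (frontier E) ⊆ interior (frontier (closure E) ∪ frontier (interior E)) :=
        interior_mono hsub
    _ = interior (frontier (closure E)) := interior_union_isClosed_of_interior_empty isClosed_frontier h2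
    _ = ∅ := h1

end Frontier

/-! ### The theorem -/

section Main

variable {m : ℕ}

/-- The projection `P_{a,b} = π(A ∩ (ℝᵐ × [a, b]))`. [folklore] -/
def projSlab (A : Set (Fin (m + 1) → ℝ)) (a b : ℝ) : Set (Fin m → ℝ) :=
  Fin.init '' (A ∩ {w | a ≤ w (Fin.last m) ∧ w (Fin.last m) ≤ b})

/-- `P_{a,b} ∈ 𝒮̃ₘ`. [cite: FornasieroServi2010, Def. 7.3] -/
theorem IsCh.projSlab_isCh {A : Set (Fin (m + 1) → ℝ)} (hA : IsCh A) (a b : ℝ) : IsCh (projSlab A a b) :=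
  (hA.inter (IsCh.slab (Fin.last m) a b)).proj

/-- The induction step. [cite: Charbonnel1991, §5] [cite: BerarducciServi2004, Lemma 6.9] -/
theorem IsCh.interior_closure_eq_empty_succ
    (hR : ∀ A : Set (Fin m → ℝ), IsCh A → interior A = ∅ → interior (_root_.closure A) = ∅)
    {A : Set (Fin (m + 1) → ℝ)} (hA : IsCh A) (hint : interior A = ∅) :
    interior (_root_.closure A) = ∅ := by
  -- (a) fibres with interior: meagre set of `x`
  have hT : IsMeagre {x : Fin m → ℝ | (interior (lastFiber A x)).Nonempty} :=
    isMeagre_setOf_interior_fiber_nonempty hA.isSigmaCompact hint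
  -- (c)–(d) the bad set, where the fibre of the closure exceeds the closure of the fibre
  let Bad : Set (Fin m → ℝ) := {x | ¬ (lastFiber (_root_.closure A) x ⊆ _root_.closure (lastFiber A x))}
  have hBad : IsMeagre Bad := by
    have hsub : Bad ⊆ ⋃ q : {q : ℚ × ℚ // q.1 < q.2},
        frontier (projSlab A q.1.1 q.1.2) := by
      intro x hx
      simp only [Bad, mem_setOf_eq, not_subset] at hx
      obtain ⟨y, hy, hycl⟩ := hx
      -- an interval around `y` missing the fibre
      rw [Metric.mem_closure_iff] at hycl
      push Not at hycl
      obtain ⟨ε, hε, hfar⟩ := hycl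
      obtain ⟨a, ha1, ha2⟩ := exists_rat_btwn (show y - ε < y by linarith)
      obtain ⟨b, hb1, hb2⟩ := exists_rat_btwn (show y < y + ε by linarith)
      have hab : a < b := by exact_mod_cast (ha2.trans hb1)
      refine mem_iUnion.2 ⟨⟨(a, b), hab⟩, ?_⟩
      rw [frontier]
      constructor
      · -- `x ∈ cl P_{a,b}`: `(x, y) ∈ cl A` with `y ∈ (a, b)`
        have hopen : IsOpen ((fun w : Fin (m + 1) → ℝ => w (Fin.last m)) ⁻¹' Ioo (a : ℝ) b) :=
          (isOpen_Ioo : IsOpen (Ioo (a : ℝ) b)).preimage (continuous_apply (Fin.last m))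
        have hyab : (Fin.snoc x y : Fin (m + 1) → ℝ) ∈
            ((fun w : Fin (m + 1) → ℝ => w (Fin.last m)) ⁻¹' Ioo (a : ℝ) b) := by
          simp only [mem_preimage, Fin.snoc_last]; exact ⟨ha2, hb1⟩
        have h1 : (Fin.snoc x y : Fin (m + 1) → ℝ) ∈
            _root_.closure (A ∩ {w | (a : ℝ) ≤ w (Fin.last m) ∧ w (Fin.last m) ≤ b}) := by
          have hmem : (Fin.snoc x y : Fin (m + 1) → ℝ) ∈
              ((fun w : Fin (m + 1) → ℝ => w (Fin.last m)) ⁻¹' Ioo (a : ℝ) b) ∩ _root_.closure A :=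
            ⟨hyab, hy⟩
          have h2 := hopen.inter_closure hmem
          refine closure_mono ?_ h2
          rintro w ⟨⟨hw1, hw2⟩, hwA⟩
          exact ⟨hwA, hw1.le, hw2.le⟩
        have hcont : Continuous (Fin.init : (Fin (m + 1) → ℝ) → (Fin m → ℝ)) :=
          continuous_pi fun i => continuous_apply (Fin.castSucc i)
        have h3 : Fin.init (Fin.snoc x y : Fin (m + 1) → ℝ) ∈
            _root_.closure (Fin.init '' (A ∩ {w | (a : ℝ) ≤ w (Fin.last m) ∧ w (Fin.last m) ≤ b})) :=
          image_closure_subset_closure_image hcont ⟨_, h1, rfl⟩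
        rw [Fin.init_snoc] at h3
        exact h3
      · -- `x ∉ int P_{a,b}` since `x ∉ P_{a,b}`: `[a, b] ∩ Aₓ = ∅`
        intro hxint
        have hxP : x ∈ projSlab A a b := interior_subset hxint
        obtain ⟨w, ⟨hwA, hwa, hwb⟩, hwx⟩ := hxP
        have hwfib : w (Fin.last m) ∈ lastFiber A x := by
          show (Fin.snoc x (w (Fin.last m)) : Fin (m + 1) → ℝ) ∈ A
          rw [← hwx, snoc_init_last]; exact hwA
        have := hfar _ hwfib
        rw [Real.dist_eq] at this
        have h4 : |y - w (Fin.last m)| < ε := by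
          rw [abs_lt]; constructor <;> linarith
        linarith
    refine IsMeagre.mono hsub (isMeagre_iUnion fun q => ?_)
    exact (isNowhereDense_frontier_of hR (hA.projSlab_isCh _ _)).isMeagre
  -- (e)–(f) conclude
  by_contra hne
  obtain ⟨z₀, hz₀⟩ := nonempty_iff_ne_empty.2 hne
  rw [mem_interior_iff_mem_nhds, Metric.mem_nhds_iff] at hz₀
  obtain ⟨r, hr, hball⟩ := hz₀
  -- a good `x` in the ball around `init z₀`
  have hres : (({x : Fin m → ℝ | (interior (lastFiber A x)).Nonempty}) ∪ Bad)ᶜ ∈ residual (Fin m → ℝ) :=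
    hT.union hBad
  have hdense := dense_of_mem_residual hres
  obtain ⟨x, hxgood, hxball⟩ := hdense.exists_mem_open Metric.isOpen_ball
    ⟨Fin.init z₀, Metric.mem_ball_self hr⟩
  rw [mem_compl_iff, mem_union, not_or] at hxgood
  obtain ⟨hxT', hxBad'⟩ := hxgood
  have hxT : interior (lastFiber A x) = ∅ := not_nonempty_iff_eq_empty.1 hxT'
  have hxBad : lastFiber (_root_.closure A) x ⊆ _root_.closure (lastFiber A x) := not_not.1 hxBad'
  have hfin : (lastFiber A x).Finite := hA.finite_lastFiber hxT
  -- the fibre of `cl A` over `x` contains an interval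
  have hIoo : Ioo (z₀ (Fin.last m) - r) (z₀ (Fin.last m) + r) ⊆ lastFiber (_root_.closure A) x := by
    intro t ht
    apply hball
    rw [Metric.mem_ball, dist_pi_lt_iff hr]
    intro i
    induction i using Fin.lastCases with
    | last =>
      simp only [Fin.snoc_last, Real.dist_eq, abs_lt]
      constructor <;> linarith [ht.1, ht.2]
    | cast i =>
      simp only [Fin.snoc_castSucc]
      have := (dist_pi_lt_iff hr).1 hxball i
      simpa [Fin.init] using this
  have hsub2 : Ioo (z₀ (Fin.last m) - r) (z₀ (Fin.last m) + r) ⊆ lastFiber A x := by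
    rw [← hfin.isClosed.closure_eq]
    exact hIoo.trans hxBad
  exact (Set.Ioo_infinite (by linarith : z₀ (Fin.last m) - r < z₀ (Fin.last m) + r))
    (hfin.subset hsub2)

/-- **Empty interior is preserved by closure, for the sets of the Charbonnel closure over `ℝ`**
(Charbonnel 1991, §5, propriété `Pₙ`; Berarducci–Servi 2004, Lemma 6.9: "*If `A ∈ 𝒮̃ₙ` has empty
interior, then so does `Ā`*"; Fornasiero–Servi 2010, Lemma 7.25): by induction on `n` through
the fibres over `ℝⁿ⁻¹`. [cite: BerarducciServi2004, Lemma 6.9] [cite: FornasieroServi2010, Lemma 7.25] [cite: Charbonnel1991, §5] -/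
theorem IsCh.interior_closure_eq_empty : ∀ {n : ℕ} {A : Set (Fin n → ℝ)}, IsCh A →
    interior A = ∅ → interior (_root_.closure A) = ∅
  | 0, A, _, hint => by
    -- `ℝ⁰` is a point: empty interior means empty
    have hA : A = ∅ := by
      rcases A.eq_empty_or_nonempty with h | ⟨x, hx⟩
      · exact h
      · have : A = Set.univ := eq_univ_of_forall fun y => by rwa [Subsingleton.elim y x]
        rw [this, interior_univ] at hint
        exact absurd hint univ_nonempty.ne_empty
    rw [hA, closure_empty, interior_empty]
  | m + 1, _, hA, hint =>
    IsCh.interior_closure_eq_empty_succ (fun _ hB hB' => IsCh.interior_closure_eq_empty hB hB') hA hint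

/-- A set of `𝒮̃` with empty interior is nowhere dense. [cite: FornasieroServi2010, Lemma 7.25] -/
theorem IsCh.isNowhereDense {n : ℕ} {A : Set (Fin n → ℝ)} (hA : IsCh A) (hint : interior A = ∅) :
    IsNowhereDense A :=
  IsCh.interior_closure_eq_empty hA hint

/-- `int(cl E) ⊆ cl(int E)` for `E ∈ 𝒮̃`. [cite: BerarducciServi2004, Lemma 6.9] -/
theorem IsCh.interior_closure_subset {n : ℕ} {E : Set (Fin n → ℝ)} (hE : IsCh E) :
    interior (_root_.closure E) ⊆ _root_.closure (interior E) :=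
  interior_closure_subset_of (fun _ hA h => IsCh.interior_closure_eq_empty hA h) hE

/-- The frontier of a set of `𝒮̃` is nowhere dense. [cite: BerarducciServi2004, Lemma 6.9] -/
theorem IsCh.isNowhereDense_frontier {n : ℕ} {E : Set (Fin n → ℝ)} (hE : IsCh E) :
    IsNowhereDense (frontier E) :=
  isNowhereDense_frontier_of (fun _ hA h => IsCh.interior_closure_eq_empty hA h) hE

/-- For `A ∈ 𝒮̃`: meagre iff empty interior (Fornasiero–Servi 2010, Lemma 7.25 (1) ⇔ (4)).
[cite: FornasieroServi2010, Lemma 7.25] -/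
theorem IsCh.isMeagre_iff_interior_eq_empty {n : ℕ} {A : Set (Fin n → ℝ)} (hA : IsCh A) :
    IsMeagre A ↔ interior A = ∅ := by
  constructor
  · intro h
    by_contra hne
    obtain ⟨x, hx⟩ := nonempty_iff_ne_empty.2 hne
    have : IsMeagre (interior A) := h.mono interior_subset
    exact (not_isMeagre_of_isOpen isOpen_interior ⟨x, hx⟩) this
  · intro h
    exact (hA.isNowhereDense h).isMeagre

end Main

end Literature.ModelTheory.ExponentialFields
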